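import Summits.Langlands.Langlands.Theses.ExteriorSquareAscent
import Literature.NumberTheory.Automorphic.PairLFunctionPolesGLOneBoundaryProofs
import Literature.NumberTheory.Automorphic.PairLFunctionPolesGLOneDedekindProofs
import Literature.NumberTheory.Automorphic.BockleHuiIrreducibleGL3AnalyticProofs
import Literature.NumberTheory.Automorphic.AutomorphicRepsGLLogDetCounterexample
import HarnessLib

/-!
# Disproof of `PairLPoleJS` — findings

Standing disprover (`cdisprove-stmt-Langlands-19093`) of the crux `PairLPoleJS` (item stmt-Langlands-19093,
route `route-Langlands-ExteriorSquareAscent`; Arthur–Clozel, Ann. of Math. Stud. 120, Ch. 3 §2 (2.3) =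
Jacquet–Shalika II Prop. 3.6 for Borel–Jacquet data: the simple POLE of `L^S(s, π × π')` at the points
`s₀ ∈ X` of `Re s = 1`).

## Verdict: NO KILL

* The crux is `Iff.rfl` the named fact
  `Literature.NumberTheory.Automorphic.JacquetShalika1981_partialPairL_pole_repData` (statement audited
  against AC (2.3), p. 171: with `β_w = q_w^{s₀-1} α_w⁻¹` one has `L^S(s, α × β) = L^S(s - s₀ + 1, π × π̃)`,
  so the typed `X` and the typed pole agree whatever the normalisation of `|·|^{s₀-1}`; no sign slip).
* Ranks `n ≤ 2` of the EXACT crux text are theorems of the tree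
  (`JacquetShalika1981_partialPairL_pole_repData_rank_of_le_two`), so a counterexample needs a
  `CuspidalAutomorphicRepData n F hF` with `3 ≤ n`; none is constructible in the tree and the statement is
  a theorem in print there (JS II 3.6 + JPSS/MW). Junk-interface escapes (non-unique Satake parameters,
  local factors with poles on `Re s = 1`) are excluded for genuine Borel–Jacquet data (Flath, JS bounds).

## Load-bearing analysis (all theorems below are sorry-free unless marked)

(a) hypotheses that ARE load-bearing — the crux with the hypothesis dropped is FALSE:
* `pairLPoleJS_false_without_finite` — drop `S.Finite`: `S = univ` empties the Euler product,
  `(s - 1) · 1 → 0`.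
* `pairLPoleJS_false_without_pos` — drop `0 < n`: the constant datum `ℂ·1/0` on `GL_0(𝔸_ℚ) = 1` has the
  empty Satake parameter everywhere, `L ≡ 1`, `(s - 1) · 1 → 0` (witness pattern of the tree's
  `OrdinaryPrimeTransportRankinSelbergPoleCount_refuted`).
* `pairLPoleJS_false_without_X` — drop the membership `s₀ ∈ X`: trivial characters of `GL_1(𝔸_ℚ)`,
  `α = β = {1}`, `s₀ = 1 + i ∉ X`: `L^S = ζ_ℚ^S` is regular and non-zero at `1 + i` (Landau; tree:
  `tendsto_tprod_eulerFactor_one_of_ne_one_numberField`), so `(s - s₀) ζ^S(s) → 0`.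
* `pairLPoleJS_false_without_satakeLink` — drop the link `HasSatakeParamAt` to cuspidal data, keeping
  cardinalities, unitarity and `X`: the rank-2 unitary family `α_w = β_w = {1, -1}` lies in `X` at
  `s₀ = 1` and gives `L^S(s) = ζ_ℚ^S(2s)²`, regular at `1`: `(s - 1) L → 0`. (Rank 1 does not suffice:
  there the weakened statement is true.) So the pole is automorphic input (`π' ≅ π̃ ⊗ |·|^{1-s₀}`), not a
  property of unitary Euler products of Satake type in `X`.

(b) hypotheses that are NOT load-bearing (information for the prover):
* `re_eq_one_of_satakeX` — `hs₀ : s₀.re = 1` is IMPLIED by unitarity + `X` + `card α_w = n > 0` at a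
  single place off `S` (norms: `q_w^{(1 - Re s₀) n} = 1`); the crux's `hs₀` is decoration.
* `hu`, `hu'` (unitarity of the central characters off `S`) and `S₀ ⊆ S` are mathematically unnecessary
  for (2.3) (twist-invariance of the statement; enlarging `S` removes finitely many non-vanishing regular
  factors) — dropping them leaves TRUE statements, so no `_false_without_` theorem exists; recorded only.

(c) natural strengthenings: see `pairLPoleJS_false_without_satakeLink` (the "Euler products only"
  strengthening is false from rank 2 on).

## Landed (negative lane, importable by ideators / planners / the lead)
* `Summits.Langlands.Langlands.Theorems.PairLPoleJS.Negative.LoadBearing` (p172833):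
  `pairLPoleJS_false_without_finite`, `pairLPoleJS_false_without_X`, `pairLPoleJS_false_without_satakeLink`,
  helpers `nhdsWithin_one_lt_re_neBot_of_re_eq_one`, `tendsto_sub_nhdsWithin_one_lt_re`,
  `eval_satakePairPolynomial_pm_one`.
* `Summits.Langlands.Langlands.Theorems.PairLPoleJS.Negative.WithoutPos` (p172650):
  `exists_glZero_hasSatakeParamAt_zero`, `pairLPoleJS_false_without_pos`.
* `Summits.Langlands.Langlands.Theorems.PairLPoleJS.Negative.ReEqOneOfSatakeX` (p172661):
  `re_eq_one_of_satakeX`.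
This work file keeps its own self-contained copies (namespace `…Cruxes.PairLPoleJS.Disproof`).

-- Targets: none served (payload `targets = []`, no line picked yet).
-/

noncomputable section

set_option linter.dupNamespace false

open scoped Topology MatrixGroups
open NumberField IsDedekindDomain MeasureTheory Filter
open Literature.NumberTheory.Automorphic AdelicGroupData
open Literature.NumberTheory.GaloisRepresentations

namespace Summit.Langlands.Langlands.Cruxes.PairLPoleJS.Disproof

/-! ### Small analytic helpers -/

/-- Every point of the line `Re s = 1` is adherent to the half-plane `Re s > 1`, so the filter of
Arthur–Clozel (2.3) at `s₀` is non-trivial. [folklore] -/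
theorem nhdsWithin_one_lt_re_neBot_of_re_eq_one {s₀ : ℂ} (hs₀ : s₀.re = 1) :
    (𝓝[{s : ℂ | 1 < s.re}] s₀).NeBot := by
  refine mem_closure_iff_nhdsWithin_neBot.mp ?_
  rw [Complex.closure_setOf_lt_re]
  simp [hs₀]

/-- `s - s₀ → 0` as `s → s₀` inside `Re s > 1`. [folklore] -/
theorem tendsto_sub_nhdsWithin_one_lt_re (s₀ : ℂ) :
    Tendsto (fun s : ℂ => s - s₀) (𝓝[{s : ℂ | 1 < s.re}] s₀) (𝓝 0) := by
  have : Tendsto (fun s : ℂ => s - s₀) (𝓝 s₀) (𝓝 (s₀ - s₀)) :=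
    (continuous_id.sub continuous_const).tendsto s₀
  rw [sub_self] at this
  exact this.mono_left nhdsWithin_le_nhds

/-- The trivial character of `GL_1(𝔸_F)` as a cuspidal Borel–Jacquet datum with Satake parameter `{1}`
at all but finitely many places (`exists_cuspidal_glOne_hasSatakeParamAt_valueAtUniformizer`, `θ = 1`).
[cite: BorelJacquet1979, 4.6] -/
theorem exists_trivial_glOne (F : Type) [Field F] [NumberField F]
    (h1 : isCompact_glFiniteIntegralLevel 1 F) :
    ∃ τ : CuspidalAutomorphicRepData 1 F h1,
      ∀ᶠ w : HeightOneSpectrum (𝓞 F) in cofinite, τ.1.HasSatakeParamAt w {1} := by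
  obtain ⟨τ, hτ⟩ := exists_cuspidal_glOne_hasSatakeParamAt_valueAtUniformizer h1 (1 : HeckeCharacter F)
  refine ⟨τ, ?_⟩
  filter_upwards [hτ] with w hw
  have h1v : (1 : HeckeCharacter F).valueAtUniformizer w = 1 := by
    rw [HeckeCharacter.valueAtUniformizer, HeckeCharacter.localComponent_apply,
      HeckeCharacter.one_apply, Units.val_one]
  rwa [h1v] at hw

/-! ### (a) Load-bearing hypotheses -/

/-- `PairLPoleJS` with the finiteness hypothesis `S.Finite` on the exceptional set DROPPED (verbatim
otherwise). -/
def PairLPoleJSWithoutFinite : Prop :=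
  ∀ (n : ℕ) (F : Type) [Field F] [NumberField F] (hF : isCompact_glFiniteIntegralLevel n F), 0 < n →
    ∀ (π π' : CuspidalAutomorphicRepData n F hF),
    ∃ S₀ : Set (HeightOneSpectrum (𝓞 F)), S₀.Finite ∧
      ∀ {S : Set (HeightOneSpectrum (𝓞 F))}, S₀ ⊆ S →
      ∀ {α β : HeightOneSpectrum (𝓞 F) → Multiset ℂ},
        (∀ w ∉ S, π.1.HasSatakeParamAt w (α w)) → (∀ w ∉ S, π'.1.HasSatakeParamAt w (β w)) →
        (∀ w ∉ S, ‖(α w).prod‖ = 1) → (∀ w ∉ S, ‖(β w).prod‖ = 1) →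
        ∀ {s₀ : ℂ}, s₀.re = 1 →
          (∀ᶠ w in cofinite, (α w).map ((((w.residueCard : ℂ) ^ (1 - s₀))) * ·) = (β w).map (·⁻¹)) →
          ∃ c : ℂ, c ≠ 0 ∧ Tendsto (fun s : ℂ => (s - s₀) *
            ∏' w : {w : HeightOneSpectrum (𝓞 F) // w ∉ S},
              ((satakePairPolynomial (α w.1) (β w.1)).eval ((w.1.residueCard : ℂ) ^ (-s)))⁻¹)
            (𝓝[{s : ℂ | 1 < s.re}] s₀) (𝓝 c)

/-- **`S.Finite` is load-bearing.** Witness: `n = 1`, `F = ℚ`, the trivial character, `S = univ ⊇ S₀`,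
`α = β = ∅` (all place-wise hypotheses are vacuous off `univ`), `s₀ = 1`: the product over the empty
index type is `1` and `(s - 1) · 1 → 0`, so no non-zero limit exists. [folklore] -/
theorem pairLPoleJS_false_without_finite : ¬ PairLPoleJSWithoutFinite := by
  intro h
  have h1 : isCompact_glFiniteIntegralLevel 1 ℚ := isCompact_glFiniteIntegralLevel_holds 1 ℚ
  obtain ⟨τ, -⟩ := exists_trivial_glOne ℚ h1
  obtain ⟨S₀, -, hmain⟩ := h 1 ℚ h1 one_pos τ τ
  obtain ⟨c, hc, hlim⟩ := hmain (S := Set.univ) (Set.subset_univ _)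
    (α := fun _ => (0 : Multiset ℂ)) (β := fun _ => (0 : Multiset ℂ))
    (fun w hw => absurd (Set.mem_univ w) hw) (fun w hw => absurd (Set.mem_univ w) hw)
    (fun w hw => absurd (Set.mem_univ w) hw) (fun w hw => absurd (Set.mem_univ w) hw)
    (s₀ := 1) Complex.one_re (Filter.Eventually.of_forall fun w => by simp)
  haveI : IsEmpty {w : HeightOneSpectrum (𝓞 ℚ) // w ∉ (Set.univ : Set (HeightOneSpectrum (𝓞 ℚ)))} :=
    ⟨fun w => w.2 (Set.mem_univ _)⟩
  have h0 : Tendsto (fun s : ℂ => (s - 1) *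
      ∏' w : {w : HeightOneSpectrum (𝓞 ℚ) // w ∉ (Set.univ : Set (HeightOneSpectrum (𝓞 ℚ)))},
        ((satakePairPolynomial ((fun _ => (0 : Multiset ℂ)) w.1)
          ((fun _ => (0 : Multiset ℂ)) w.1)).eval ((w.1.residueCard : ℂ) ^ (-s)))⁻¹)
      (𝓝[{s : ℂ | 1 < s.re}] 1) (𝓝 0) := by
    simp only [tprod_empty, mul_one]
    exact tendsto_sub_one_nhdsWithin_one_lt_re
  exact hc (tendsto_nhds_unique hlim h0)

/-- `PairLPoleJS` with the rank guard `0 < n` DROPPED (verbatim otherwise). -/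
def PairLPoleJSWithoutPos : Prop :=
  ∀ (n : ℕ) (F : Type) [Field F] [NumberField F] (hF : isCompact_glFiniteIntegralLevel n F),
    ∀ (π π' : CuspidalAutomorphicRepData n F hF),
    ∃ S₀ : Set (HeightOneSpectrum (𝓞 F)), S₀.Finite ∧
      ∀ {S : Set (HeightOneSpectrum (𝓞 F))}, S.Finite → S₀ ⊆ S →
      ∀ {α β : HeightOneSpectrum (𝓞 F) → Multiset ℂ},
        (∀ w ∉ S, π.1.HasSatakeParamAt w (α w)) → (∀ w ∉ S, π'.1.HasSatakeParamAt w (β w)) →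
        (∀ w ∉ S, ‖(α w).prod‖ = 1) → (∀ w ∉ S, ‖(β w).prod‖ = 1) →
        ∀ {s₀ : ℂ}, s₀.re = 1 →
          (∀ᶠ w in cofinite, (α w).map ((((w.residueCard : ℂ) ^ (1 - s₀))) * ·) = (β w).map (·⁻¹)) →
          ∃ c : ℂ, c ≠ 0 ∧ Tendsto (fun s : ℂ => (s - s₀) *
            ∏' w : {w : HeightOneSpectrum (𝓞 F) // w ∉ S},
              ((satakePairPolynomial (α w.1) (β w.1)).eval ((w.1.residueCard : ℂ) ^ (-s)))⁻¹)
            (𝓝[{s : ℂ | 1 < s.re}] s₀) (𝓝 c)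

/-- **The constant datum on `GL_0`.** `GL_0(𝔸_ℚ)` is the trivial group, the constants `ℂ · 1` are cusp
forms (Borel–Jacquet 4.2 (a)–(d) hold trivially and the cusp condition `0 < k < 0` is empty), so
`π₀ = ℂ·1 / 0` is a `CuspidalAutomorphicRepData 0 ℚ hcpt`; its Satake parameter at every finite place is
the EMPTY multiset (the only Hecke operator `[K(𝔫) t_{v,0} K(𝔫)] = [K(𝔫)]` is the identity). This is the
witness of the tree's `OrdinaryPrimeTransportRankinSelbergPoleCount_refuted` (stmt-Langlands-17212),
re-proved here. [folklore] -/
theorem exists_glZero_hasSatakeParamAt_zero (hcpt : isCompact_glFiniteIntegralLevel 0 ℚ) :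
    ∃ π₀ : CuspidalAutomorphicRepData 0 ℚ hcpt, ∀ v : HeightOneSpectrum (𝓞 ℚ), π₀.1.HasSatakeParamAt v 0 := by
  classical
  -- `GL_0(𝔸_ℚ)` is the trivial group
  haveI hsub : Subsingleton ((AdelicGroupData.gl 0 ℚ).Adelic) := by
    change Subsingleton (GL (Fin 0) (AdeleRing (𝓞 ℚ) ℚ))
    infer_instance
  -- (1) the constant `1` is an automorphic form on `GL_0(𝔸_ℚ)` (BJ 4.2; growth with `C = 1`, `r = 0`)
  have hA : IsAutomorphicForm (AutomorphyDatum.gl 0 ℚ hcpt)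
      (1 : (AdelicGroupData.gl 0 ℚ).Adelic → ℂ) :=
    { leftInvariant := isLeftInvariant_affLogDet one_eq_aff
      exists_level := by
        obtain ⟨U, hU⟩ := finiteLevelsGL_nonempty 0 ℚ hcpt
        exact ⟨U, hU, isRightInvariantUnder_affLogDet one_eq_aff hU⟩
      archSmooth := isArchSmooth_affLogDet one_eq_aff
      kFinite := isKFinite_affLogDet one_eq_aff
      zFinite := isZFinite_affLogDet one_eq_aff
      moderateGrowth := ⟨1, 0, fun g => by simp⟩ }
  -- (2) `ℂ · 1` and `0` are stable spaces of automorphic forms, `ℂ · 1` consists of cusp forms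
  have hS1 : IsStableSubmodule (AutomorphyDatum.gl 0 ℚ hcpt)
      (Submodule.span ℂ {(1 : (AdelicGroupData.gl 0 ℚ).Adelic → ℂ)}) :=
    { le_automorphicForms := Submodule.span_le.2 (by
        rintro θ rfl
        exact hA.mem_automorphicForms)
      finite_stable := fun h' _ => span_one_le_comap_rightTranslation h'
      k_stable := fun k => span_one_le_comap_rightTranslation _
      lie_stable := fun X θ hθ => by
        obtain ⟨c, rfl⟩ := Submodule.mem_span_singleton.1 hθ
        rw [lieDeriv_smul, lieDeriv_one_gl, smul_zero]
        exact Submodule.zero_mem _ }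
  have hS0 : IsStableSubmodule (AutomorphyDatum.gl 0 ℚ hcpt)
      (⊥ : Submodule ℂ ((AdelicGroupData.gl 0 ℚ).Adelic → ℂ)) :=
    { le_automorphicForms := bot_le
      finite_stable := fun _ _ => bot_le
      k_stable := fun _ => bot_le
      lie_stable := fun X θ hθ => by
        rw [(Submodule.mem_bot ℂ).1 hθ]
        have h0 : lieDeriv (AutomorphyDatum.gl 0 ℚ hcpt).ofArch X
            (0 : (AdelicGroupData.gl 0 ℚ).Adelic → ℂ) = 0 := by
          funext g
          simp [lieDeriv]
        rw [h0]
        exact Submodule.zero_mem _ }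
  have hcusp : Submodule.span ℂ {(1 : (AdelicGroupData.gl 0 ℚ).Adelic → ℂ)} ≤ cuspFormsGL 0 ℚ hcpt := by
    refine Submodule.span_le.2 ?_
    rintro θ rfl
    exact IsCuspFormGL.mem_cuspFormsGL ⟨hA, fun k hk hk0 => absurd hk0 (by omega)⟩
  -- (3) the cuspidal datum `π₀ = ℂ · 1 / 0` (a line, hence irreducible)
  obtain ⟨π₀, hW, hW'⟩ : ∃ π₀ : CuspidalAutomorphicRepData 0 ℚ hcpt,
      π₀.1.W = Submodule.span ℂ {(1 : (AdelicGroupData.gl 0 ℚ).Adelic → ℂ)} ∧ π₀.1.W' = ⊥ :=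
    ⟨⟨{ W := Submodule.span ℂ {(1 : (AdelicGroupData.gl 0 ℚ).Adelic → ℂ)}
        W' := ⊥
        lt := bot_lt_iff_ne_bot.2 (by
          rw [Ne, Submodule.span_singleton_eq_bot]
          exact one_ne_zero)
        stable := hS1
        stable' := hS0
        irreducible := fun W'' _ h₂ _ =>
          (nonzero_span_atom (1 : (AdelicGroupData.gl 0 ℚ).Adelic → ℂ) one_ne_zero).le_iff.1 h₂ },
      hcusp⟩, rfl, rfl⟩
  -- (4) on the trivial group every double-coset Hecke operator `[U g U] = [U]` is the identity
  have hHecke : ∀ (U : Subgroup (AdelicGroupData.gl 0 ℚ).Adelic) (g : (AdelicGroupData.gl 0 ℚ).Adelic)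
      (φ : (AdelicGroupData.gl 0 ℚ).Adelic → ℂ),
      heckeOperator (rightTranslation (AdelicGroupData.gl 0 ℚ)) U g φ = φ := by
    intro U g φ
    have hφ : φ ∈ (rightTranslation (AdelicGroupData.gl 0 ℚ)).fixedPoints U := by
      rw [← isRightInvariantUnder_iff_mem_fixedPoints]
      intro u _ x
      rw [Subsingleton.elim (x * u) x]
    have hall : ∀ y : (AdelicGroupData.gl 0 ℚ).Adelic ⧸ U,
        y = ((1 : (AdelicGroupData.gl 0 ℚ).Adelic) : (AdelicGroupData.gl 0 ℚ).Adelic ⧸ U) :=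
      fun y => QuotientGroup.induction_on y fun z => congrArg _ (Subsingleton.elim z 1)
    have hs : Set.BijOn (fun x : (AdelicGroupData.gl 0 ℚ).Adelic => (x : (AdelicGroupData.gl 0 ℚ).Adelic ⧸ U))
        (({1} : Finset (AdelicGroupData.gl 0 ℚ).Adelic) : Set (AdelicGroupData.gl 0 ℚ).Adelic)
        (MulAction.orbit U (g : (AdelicGroupData.gl 0 ℚ).Adelic ⧸ U)) := by
      refine ⟨?_, ?_, ?_⟩
      · intro x _
        show (x : (AdelicGroupData.gl 0 ℚ).Adelic ⧸ U) ∈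
          MulAction.orbit U (g : (AdelicGroupData.gl 0 ℚ).Adelic ⧸ U)
        rw [hall (x : (AdelicGroupData.gl 0 ℚ).Adelic ⧸ U), ← hall (g : (AdelicGroupData.gl 0 ℚ).Adelic ⧸ U)]
        exact MulAction.mem_orbit_self _
      · simp
      · intro y _
        exact ⟨1, Finset.mem_coe.2 (Finset.mem_singleton_self _), (hall y).symm⟩
    rw [heckeOperator_apply_eq_sum _ U g {1} hs hφ, Finset.sum_singleton, map_one, Module.End.one_apply]
  -- (5) `π₀` has the empty Satake parameter at every finite place (level `1`, eigenform `1`)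
  refine ⟨π₀, fun v => ?_⟩
  obtain ⟨ϖ₀, hϖ₀⟩ := v.valuation_exists_uniformizer ℚ
  have hval' : Valued.v (algebraMap ℚ (v.adicCompletion ℚ) ϖ₀) = v.valuation ℚ ϖ₀ :=
    HeightOneSpectrum.valuedAdicCompletion_eq_valuation' v ϖ₀
  have hval : Valued.v (algebraMap ℚ (v.adicCompletion ℚ) ϖ₀) = WithZero.exp (-1 : ℤ) := by
    rw [hval', hϖ₀]
  have hne : algebraMap ℚ (v.adicCompletion ℚ) ϖ₀ ≠ 0 := fun h0 => by
    rw [h0, map_zero] at hval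
    exact WithZero.coe_ne_zero hval.symm
  refine ⟨⊤, Units.mk0 _ hne, ?_, ?_, hval, rfl, 1, ?_, ?_, ?_, ?_⟩
  · simp
  · intro hdvd
    exact v.isPrime.ne_top (top_le_iff.1 (Ideal.dvd_iff_le.1 hdvd))
  · rw [hW]
    exact Submodule.mem_span_singleton_self _
  · rw [hW', Submodule.mem_bot]
    exact one_ne_zero
  · intro u _
    rfl
  · intro i hi
    obtain rfl : i = 0 := Nat.le_zero.1 hi
    rw [hW', Submodule.mem_bot, hHecke]
    have h1 : ((((Real.sqrt (v.residueCard : ℝ)) : ℝ) : ℂ) ^ (0 * (0 - 0)) *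
        (0 : Multiset ℂ).esymm 0) = 1 := by
      simp [Multiset.esymm]
    rw [h1, one_smul, sub_self]

/-- **`0 < n` is load-bearing.** Witness: `n = 0`, `F = ℚ`, `π = π' = ℂ·1/0` on `GL_0(𝔸_ℚ) = 1`
(`exists_glZero_hasSatakeParamAt_zero`), `S = S₀`, `α = β = ∅` (Satake parameters of `π₀`, unitary:
`|∏ ∅| = 1`, and in `X`: `∅ = ∅`), `s₀ = 1`: every local factor is `P(∅, ∅; x)⁻¹ = 1`, so `L ≡ 1` and
`(s - 1) · 1 → 0`: no non-zero limit. [folklore] -/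
theorem pairLPoleJS_false_without_pos : ¬ PairLPoleJSWithoutPos := by
  intro h
  have hcpt : isCompact_glFiniteIntegralLevel 0 ℚ := isCompact_glFiniteIntegralLevel_holds 0 ℚ
  obtain ⟨π₀, hSat⟩ := exists_glZero_hasSatakeParamAt_zero hcpt
  obtain ⟨S₀, hS₀, hmain⟩ := h 0 ℚ hcpt π₀ π₀
  obtain ⟨c, hc, hlim⟩ := hmain hS₀ subset_rfl
    (α := fun _ => (0 : Multiset ℂ)) (β := fun _ => (0 : Multiset ℂ))
    (fun w _ => hSat w) (fun w _ => hSat w) (fun w _ => by simp) (fun w _ => by simp)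
    (s₀ := 1) Complex.one_re (Filter.Eventually.of_forall fun w => by simp)
  have h0 : Tendsto (fun s : ℂ => (s - 1) *
      ∏' w : {w : HeightOneSpectrum (𝓞 ℚ) // w ∉ S₀},
        ((satakePairPolynomial ((fun _ => (0 : Multiset ℂ)) w.1)
          ((fun _ => (0 : Multiset ℂ)) w.1)).eval ((w.1.residueCard : ℂ) ^ (-s)))⁻¹)
      (𝓝[{s : ℂ | 1 < s.re}] 1) (𝓝 0) := by
    have h1 : ∀ s : ℂ, (∏' w : {w : HeightOneSpectrum (𝓞 ℚ) // w ∉ S₀},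
        ((satakePairPolynomial ((fun _ => (0 : Multiset ℂ)) w.1)
          ((fun _ => (0 : Multiset ℂ)) w.1)).eval ((w.1.residueCard : ℂ) ^ (-s)))⁻¹) = 1 := by
      intro s
      simp [satakePairPolynomial]
    simp only [h1, mul_one]
    exact tendsto_sub_one_nhdsWithin_one_lt_re
  exact hc (tendsto_nhds_unique hlim h0)

/-- `PairLPoleJS` with the membership `s₀ ∈ X` (`∀ᶠ w in cofinite, q_w^{1-s₀} α_w = β_w⁻¹`) DROPPED
(verbatim otherwise). -/
def PairLPoleJSWithoutX : Prop :=
  ∀ (n : ℕ) (F : Type) [Field F] [NumberField F] (hF : isCompact_glFiniteIntegralLevel n F), 0 < n →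
    ∀ (π π' : CuspidalAutomorphicRepData n F hF),
    ∃ S₀ : Set (HeightOneSpectrum (𝓞 F)), S₀.Finite ∧
      ∀ {S : Set (HeightOneSpectrum (𝓞 F))}, S.Finite → S₀ ⊆ S →
      ∀ {α β : HeightOneSpectrum (𝓞 F) → Multiset ℂ},
        (∀ w ∉ S, π.1.HasSatakeParamAt w (α w)) → (∀ w ∉ S, π'.1.HasSatakeParamAt w (β w)) →
        (∀ w ∉ S, ‖(α w).prod‖ = 1) → (∀ w ∉ S, ‖(β w).prod‖ = 1) →
        ∀ {s₀ : ℂ}, s₀.re = 1 →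
          ∃ c : ℂ, c ≠ 0 ∧ Tendsto (fun s : ℂ => (s - s₀) *
            ∏' w : {w : HeightOneSpectrum (𝓞 F) // w ∉ S},
              ((satakePairPolynomial (α w.1) (β w.1)).eval ((w.1.residueCard : ℂ) ^ (-s)))⁻¹)
            (𝓝[{s : ℂ | 1 < s.re}] s₀) (𝓝 c)

/-- **`s₀ ∈ X` is load-bearing (no pole off `X`).** Witness: `n = 1`, `F = ℚ`, `π = π'` the trivial
character, `α = β = {1}`, `s₀ = 1 + i` (so `Re s₀ = 1`, and `s₀ ∉ X`): the partial product is `ζ_ℚ^S(s)`,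
regular and non-zero at `1 + i` (Landau 1903; tree `tendsto_tprod_eulerFactor_one_of_ne_one_numberField`),
hence `(s - s₀) ζ_ℚ^S(s) → 0` and no non-zero limit exists. [cite: ArthurClozelAMS120, Ch. 3 §2 (2.2)–(2.3), p. 171] -/
theorem pairLPoleJS_false_without_X : ¬ PairLPoleJSWithoutX := by
  intro h
  have h1 : isCompact_glFiniteIntegralLevel 1 ℚ := isCompact_glFiniteIntegralLevel_holds 1 ℚ
  obtain ⟨τ, hτ⟩ := exists_trivial_glOne ℚ h1
  obtain ⟨S₀, hS₀, hmain⟩ := h 1 ℚ h1 one_pos τ τ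
  have hE : {w : HeightOneSpectrum (𝓞 ℚ) | ¬ τ.1.HasSatakeParamAt w {1}}.Finite :=
    Filter.eventually_cofinite.1 hτ
  obtain ⟨S, hSdef⟩ : ∃ S : Set (HeightOneSpectrum (𝓞 ℚ)),
      S = S₀ ∪ {w | ¬ τ.1.HasSatakeParamAt w {1}} := ⟨_, rfl⟩
  have hS : S.Finite := hSdef ▸ hS₀.union hE
  have hS₀S : S₀ ⊆ S := hSdef ▸ Set.subset_union_left
  have hα : ∀ w ∉ S, τ.1.HasSatakeParamAt w ((fun _ => ({1} : Multiset ℂ)) w) := by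
    intro w hw
    by_contra hno
    exact hw (hSdef ▸ Or.inr hno)
  have hu : ∀ w ∉ S, ‖((fun _ => ({1} : Multiset ℂ)) w).prod‖ = 1 := by
    intro w _
    simp
  have hre : (1 + Complex.I).re = 1 := by simp
  obtain ⟨c, hc, hlim⟩ := hmain hS hS₀S hα hα hu hu hre
  have hfun : (fun s : ℂ => (s - (1 + Complex.I)) * ∏' w : {w : HeightOneSpectrum (𝓞 ℚ) // w ∉ S},
      ((satakePairPolynomial ((fun _ => ({1} : Multiset ℂ)) w.1)
        ((fun _ => ({1} : Multiset ℂ)) w.1)).eval ((w.1.residueCard : ℂ) ^ (-s)))⁻¹) =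
      fun s : ℂ => (s - (1 + Complex.I)) * ∏' w : {w : HeightOneSpectrum (𝓞 ℚ) // w ∉ S},
        (1 - ((w.1.residueCard : ℂ) ^ (-s)))⁻¹ := by
    funext s
    congr 1
    refine tprod_congr fun w => ?_
    rw [eval_satakePairPolynomial_singleton, one_mul, one_mul]
  rw [hfun] at hlim
  have hne : (1 + Complex.I : ℂ) ≠ 1 := by
    intro h'
    have := congrArg Complex.im h'
    simp at this
  obtain ⟨c', -, hreg⟩ :=
    tendsto_tprod_eulerFactor_one_of_ne_one_numberField (K := ℚ) hS (s₀ := 1 + Complex.I)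
      (le_of_eq hre.symm) hne
  have h0 := (tendsto_sub_nhdsWithin_one_lt_re (1 + Complex.I)).mul hreg
  rw [zero_mul] at h0
  haveI := nhdsWithin_one_lt_re_neBot_of_re_eq_one hre
  exact hc (tendsto_nhds_unique hlim h0)

/-- `PairLPoleJS` with the LINK `HasSatakeParamAt` of `α`, `β` to cuspidal data DROPPED, keeping only what
it implies numerically: the cardinalities `card α_w = card β_w = n` (`HasSatakeParamAt.card_eq`), plus the
unitarity clauses and `X` verbatim (the data `hF`, `π`, `π'` then no longer occur and are removed). -/
def PairLPoleJSWithoutSatakeLink : Prop :=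
  ∀ (n : ℕ) (F : Type) [Field F] [NumberField F], 0 < n →
    ∃ S₀ : Set (HeightOneSpectrum (𝓞 F)), S₀.Finite ∧
      ∀ {S : Set (HeightOneSpectrum (𝓞 F))}, S.Finite → S₀ ⊆ S →
      ∀ {α β : HeightOneSpectrum (𝓞 F) → Multiset ℂ},
        (∀ w ∉ S, Multiset.card (α w) = n) → (∀ w ∉ S, Multiset.card (β w) = n) →
        (∀ w ∉ S, ‖(α w).prod‖ = 1) → (∀ w ∉ S, ‖(β w).prod‖ = 1) →
        ∀ {s₀ : ℂ}, s₀.re = 1 →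
          (∀ᶠ w in cofinite, (α w).map ((((w.residueCard : ℂ) ^ (1 - s₀))) * ·) = (β w).map (·⁻¹)) →
          ∃ c : ℂ, c ≠ 0 ∧ Tendsto (fun s : ℂ => (s - s₀) *
            ∏' w : {w : HeightOneSpectrum (𝓞 F) // w ∉ S},
              ((satakePairPolynomial (α w.1) (β w.1)).eval ((w.1.residueCard : ℂ) ^ (-s)))⁻¹)
            (𝓝[{s : ℂ | 1 < s.re}] s₀) (𝓝 c)

/-- The local factor of the rank-2 family `{1, -1} × {1, -1}` is `(1 - x²)²`. [folklore] -/
theorem eval_satakePairPolynomial_pm_one (x : ℂ) :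
    (satakePairPolynomial ({1, -1} : Multiset ℂ) ({1, -1} : Multiset ℂ)).eval x =
      (1 - x ^ 2) * (1 - x ^ 2) := by
  simp only [satakePairPolynomial, Multiset.insert_eq_cons, Multiset.cons_product, Multiset.product_cons,
    Multiset.product_singleton, Multiset.map_cons, Multiset.map_singleton, Multiset.prod_cons,
    Multiset.prod_singleton, Polynomial.eval_mul, Polynomial.eval_sub, Polynomial.eval_one,
    Polynomial.eval_C, Polynomial.eval_X, Multiset.singleton_add, Multiset.cons_add, Multiset.add_cons]
  ring

/-- **The Satake linkage is load-bearing (a unitary family IN `X` with NO pole).** Witness: `n = 2`,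
`F = ℚ`, `α_w = β_w = {1, -1}`, `s₀ = 1`: `X` holds at every place (`q_w^0 · {1,-1} = {1,-1}⁻¹`), the
family is unitary (`|∏ α_w| = 1`), and `L^S(s) = ∏_{p ∉ S} (1 - p^{-2s})^{-2} = ζ_ℚ^S(2s)²` is regular at
`s = 1` (continuity of `ζ_ℚ` at `2` through `tprod_eulerFactor_one_eq_dedekindZetaCont_mul_prod`), so
`(s - 1) L^S(s) → 0`: no non-zero limit. In rank `1` the weakened statement is TRUE
(`α_w β_w = q_w^{s₀-1}`, `L^S = ζ^S(s - s₀ + 1)`), so rank `2` is the minimal witness. [folklore] -/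
theorem pairLPoleJS_false_without_satakeLink : ¬ PairLPoleJSWithoutSatakeLink := by
  intro h
  obtain ⟨S, hS, hmain⟩ := h 2 ℚ two_pos
  have hX : ∀ᶠ w : HeightOneSpectrum (𝓞 ℚ) in cofinite,
      ((fun _ => ({1, -1} : Multiset ℂ)) w).map ((((w.residueCard : ℂ) ^ (1 - (1 : ℂ)))) * ·) =
        ((fun _ => ({1, -1} : Multiset ℂ)) w).map (·⁻¹) :=
    Filter.Eventually.of_forall fun w => by simp
  obtain ⟨c, hc, hlim⟩ := hmain hS subset_rfl (α := fun _ => ({1, -1} : Multiset ℂ))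
    (β := fun _ => ({1, -1} : Multiset ℂ)) (fun w _ => by simp) (fun w _ => by simp)
    (fun w _ => by simp) (fun w _ => by simp) Complex.one_re hX
  -- `Z = ζ_ℚ^S`
  set Z : ℂ → ℂ := fun s => ∏' w : {w : HeightOneSpectrum (𝓞 ℚ) // w ∉ S},
    (1 - ((w.1.residueCard : ℂ) ^ (-s)))⁻¹ with hZdef
  -- the partial product of the family is `Z(2s)²` on `Re s > 1`
  have hfun : ∀ s : ℂ, 1 < s.re →
      (∏' w : {w : HeightOneSpectrum (𝓞 ℚ) // w ∉ S},
        ((satakePairPolynomial ((fun _ => ({1, -1} : Multiset ℂ)) w.1)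
          ((fun _ => ({1, -1} : Multiset ℂ)) w.1)).eval ((w.1.residueCard : ℂ) ^ (-s)))⁻¹) =
        Z (2 * s) * Z (2 * s) := by
    intro s hs
    have hs2 : 1 < (2 * s).re := by
      simp only [Complex.mul_re, Complex.re_ofNat, Complex.im_ofNat, zero_mul, sub_zero]
      linarith
    have hmulZ := multipliable_inv_one_sub_residueCard_cpow_neg (K := ℚ) S hs2
    rw [hZdef, ← hmulZ.tprod_mul hmulZ]
    refine tprod_congr fun w => ?_
    have hq : (w.1.residueCard : ℂ) ≠ 0 :=
      Nat.cast_ne_zero.2 (ne_of_gt (lt_trans zero_lt_one w.1.one_lt_residueCard))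
    have hsq : ((w.1.residueCard : ℂ) ^ (-s)) ^ 2 = (w.1.residueCard : ℂ) ^ (-(2 * s)) := by
      rw [sq, ← Complex.cpow_add _ _ hq]
      congr 1
      ring
    rw [eval_satakePairPolynomial_pm_one, hsq, mul_inv]
  -- continuity of `s ↦ Z (2s)` at `1`, through `ζ_ℚ`
  classical
  set E : ℂ → ℂ := fun s => ∏ v ∈ hS.toFinset, (1 - ((v.residueCard : ℂ) ^ (-s))) with hEdef
  have hcontH := Literature.NumberTheory.LFunctions.NumberField.exists_isDedekindZetaContinuation_holds ℚ
  have hζdiff := Literature.NumberTheory.LFunctions.differentiableOn_dedekindZetaCont_of_exists ℚ hcontH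
  have h2ne : (2 : ℂ) * 1 ≠ 1 := by norm_num
  have hG : ContinuousAt (fun s : ℂ =>
      Literature.NumberTheory.LFunctions.dedekindZetaCont ℚ (2 * s) * E (2 * s)) 1 := by
    have h2 : Continuous fun s : ℂ => 2 * s := continuous_const.mul continuous_id
    refine ContinuousAt.mul ?_ ?_
    · have hζ : ContinuousAt (Literature.NumberTheory.LFunctions.dedekindZetaCont ℚ) (2 * 1) :=
        (hζdiff.differentiableAt (isOpen_compl_singleton.mem_nhds h2ne)).continuousAt
      exact ContinuousAt.comp (g := Literature.NumberTheory.LFunctions.dedekindZetaCont ℚ) hζ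
        h2.continuousAt
    · have hE : Continuous E := by
        refine continuous_finsetProd _ fun v _ => continuous_one_sub_residueCard_cpow_neg v
      exact (hE.comp h2).continuousAt
  have hZ2 : Tendsto (fun s : ℂ => Z (2 * s)) (𝓝[{s : ℂ | 1 < s.re}] 1)
      (𝓝 (Literature.NumberTheory.LFunctions.dedekindZetaCont ℚ (2 * 1) * E (2 * 1))) := by
    refine (hG.tendsto.mono_left nhdsWithin_le_nhds).congr' ?_
    filter_upwards [self_mem_nhdsWithin] with s hs
    have hs2 : 1 < (2 * s).re := by
      simp only [Complex.mul_re, Complex.re_ofNat, Complex.im_ofNat, zero_mul, sub_zero]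
      have : 1 < s.re := hs
      linarith
    exact (tprod_eulerFactor_one_eq_dedekindZetaCont_mul_prod hS hs2).symm
  -- `(s - 1) · Z(2s)² → 0 · Z(2)² = 0`
  have h0 : Tendsto (fun s : ℂ => (s - 1) *
      ∏' w : {w : HeightOneSpectrum (𝓞 ℚ) // w ∉ S},
        ((satakePairPolynomial ((fun _ => ({1, -1} : Multiset ℂ)) w.1)
          ((fun _ => ({1, -1} : Multiset ℂ)) w.1)).eval ((w.1.residueCard : ℂ) ^ (-s)))⁻¹)
      (𝓝[{s : ℂ | 1 < s.re}] 1) (𝓝 0) := by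
    have hprod := tendsto_sub_one_nhdsWithin_one_lt_re.mul (hZ2.mul hZ2)
    rw [zero_mul] at hprod
    refine hprod.congr' ?_
    filter_upwards [self_mem_nhdsWithin] with s hs
    rw [hfun s hs]
  exact hc (tendsto_nhds_unique hlim h0)

/-! ### (b) A hypothesis that is NOT load-bearing: `Re s₀ = 1` follows from unitarity and `X` -/

/-- **`hs₀` is redundant.** If `α`, `β` are unitary off a finite `S` (`|∏ α_w| = |∏ β_w| = 1`),
`card α_w = n > 0` off `S`, and `s₀ ∈ X` (`q_w^{1-s₀} α_w = β_w⁻¹` as multisets for almost all `w`),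
then `Re s₀ = 1`: at one place `w ∉ S` where `X` holds, taking products and norms gives
`q_w^{(1 - Re s₀) n} = 1` with `q_w > 1`. So in `PairLPoleJS` the hypothesis `s₀.re = 1` is implied by
the others (with `card α_w = n` from `HasSatakeParamAt.card_eq`). [folklore] -/
theorem re_eq_one_of_satakeX {F : Type} [Field F] [NumberField F] {n : ℕ} (hn : 0 < n)
    {S : Set (HeightOneSpectrum (𝓞 F))} (hS : S.Finite) {α β : HeightOneSpectrum (𝓞 F) → Multiset ℂ}
    (hcard : ∀ w ∉ S, Multiset.card (α w) = n)
    (hu : ∀ w ∉ S, ‖(α w).prod‖ = 1) (hu' : ∀ w ∉ S, ‖(β w).prod‖ = 1) {s₀ : ℂ}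
    (hX : ∀ᶠ w in cofinite, (α w).map ((((w.residueCard : ℂ) ^ (1 - s₀))) * ·) = (β w).map (·⁻¹)) :
    s₀.re = 1 := by
  haveI := infinite_heightOneSpectrum F
  obtain ⟨w, hXw, hwS⟩ := (hX.and hS.eventually_cofinite_notMem).exists
  have hq1 : 1 < w.residueCard := w.one_lt_residueCard
  have hprod := congrArg Multiset.prod hXw
  rw [Multiset.prod_map_mul, Multiset.map_const', Multiset.prod_replicate, Multiset.map_id',
    Multiset.prod_map_inv, Multiset.map_id', hcard w hwS] at hprod
  have hnorm := congrArg norm hprod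
  rw [norm_mul, norm_pow, norm_inv, hu w hwS, hu' w hwS, mul_one, inv_one,
    pow_eq_one_iff_of_nonneg (norm_nonneg _) hn.ne',
    Complex.norm_natCast_cpow_of_pos (lt_trans zero_lt_one hq1)] at hnorm
  have hlog := congrArg Real.log hnorm
  rw [Real.log_rpow (by exact_mod_cast lt_trans zero_lt_one hq1), Real.log_one, mul_eq_zero] at hlog
  rcases hlog with h | h
  · rw [Complex.sub_re, Complex.one_re] at h
    linarith
  · have := Real.log_pos (by exact_mod_cast hq1 : (1 : ℝ) < w.residueCard)
    linarith

end Summit.Langlands.Langlands.Cruxes.PairLPoleJS.Disproof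

end
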